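import Literature.NumberTheory.Automorphic.ConjugateSelfDualCharacters
import Literature.NumberTheory.Automorphic.UnitaryLineArchTypes
import Literature.NumberTheory.Automorphic.InfiniteIdelePolar
import Literature.RepresentationTheory.CompactGroups.CircleCharacters
import HarnessLib

/-!
# The infinity type of a conjugate self-dual character EXISTS ([Liu21] Remark 4.2, existence half)

Topic `NumberTheory/Automorphic`; namespace `Literature.NumberTheory.Automorphic` (sub-namespaces
`InfiniteAdeleRing`, `IdeleClassGroup`).  `L` a CM field, `L⁺ = maximalRealSubfield L`, `c` its complex
conjugation, `L_∞ = InfiniteAdeleRing L`, `ι_w : L_w →+* ℂ` the tree's `extensionEmbedding w`.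

Y. Liu, *Fourier–Jacobi cycles and arithmetic relative trace formula*, Camb. J. Math. 9 (2021),
arXiv:2102.11518, Remark 4.2 (p. 18 L28–35 of the arXiv text `paper:arxiv-2102.11518`, verbatim):
"A conjugate self-dual automorphic character is necessarily strictly unitary [...]. For a conjugate
symplectic (resp. conjugate orthogonal) automorphic character μ, there exist a CM type Φ_μ and a unique
tuple 𝔴_μ = (𝔴_τ)_{τ ∈ Σ_F} of odd (resp. even) nonnegative integers such that for every τ ∈ Σ_F, the
component μ_τ : (E ⊗_{F,τ} ℝ)^× → ℂ^× is the character z ↦ arg(z)^{−𝔴_τ}, where we have identified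
(E ⊗_{F,τ} ℝ)^× with ℂ^× via the unique element τ' ∈ Φ_μ above τ."

The companion file `ConjugateSelfDualCharacters` proves the PARITY and UNIQUENESS statements of the
remark for characters `ψ : C_L →ₜ* S¹` that HAVE an ∞-type `e` (`IsConjugateSymplectic.odd`,
`IsConjugateOrthogonal.even`, `hasInfinityType_unique`).  This file proves the EXISTENCE statement and
then packages Definition 4.3 as functions of `ψ`:

* § 1 `InfiniteAdeleRing.relNormOneInfUnits_eq_normOneTorus`: for a CM field the archimedean torus
  `U(1)(L⁺ ⊗ ℝ) = {y · ȳ = 1}` (`RelNormOneTorusArch`) IS the norm-one torus `{‖y_w‖ = 1 ∀ w}` of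
  `InfiniteIdelePolar`.
* § 2 positive real archimedean units `p` (`InfiniteIdelePolar.posRealUnits`): `p = s · (c • s)` for the
  positive real square root `s` (complex conjugation fixes real components,
  `extensionEmbedding_complexConj_smul_units_apply`), and `p = s_L · s_L` for the base change `s_L`
  (`infiniteIdeleBaseChange L⁺ L s`) of a TOTALLY POSITIVE unit `s ∈ L⁺_∞ˣ`, on whose class the quadratic
  character `ε_{L/L⁺}` is `1` (`quadraticClassCharCM_infUnitsToClass_eq_one_of_pos`, from the tree's
  sign-product formula `quadraticClassCharCM_infUnitsToClass_eq_prod`).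
* § 3 `InfiniteAdeleRing.exists_eq_infinityTypeChar_of_posRealUnits`: every continuous character
  `χ : L_∞ˣ →* S¹` trivial on the positive real units is the ∞-type character
  `infinityTypeChar L e : u ↦ ∏_w (ι_w u_w / |ι_w u_w|)^{e w}` of a unique (`existsUnique_…`) tuple
  `e : InfinitePlace L → ℤ`.  Proof: polar decomposition `u = p · t` (`InfiniteIdelePolar`), `χ p = 1`,
  and on the torus `∏_w U(1)` the character is `z ↦ z^{e w}` on each one-place subtorus
  (`UnitaryLineArchTypes.archCoord`, `eq_prod_archCoord`; `CircleChar.eq_zpow`: the continuous characters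
  of `U(1)` are `z ↦ z^n`).  Variant `…_of_mul_conj_smul` (hypothesis `χ (y · c•y) = 1`).
* § 4 `IdeleClassGroup.IsConjugateSelfDual.exists_hasInfinityType`,
  `IsConjugateSymplectic.exists_hasInfinityType` (NO self-duality hypothesis: `ψ[s_L] = ε[s] = 1` for `s`
  totally positive), `IsConjugateOrthogonal.exists_hasInfinityType_even`, `existsUnique` forms, and
  `IsConjugateSymplectic.exists_hasInfinityType_odd` (an ∞-type with all exponents odd, odd weights, a CM
  type) — Remark 4.2 in full for conjugate symplectic `ψ`.
* § 5 Definition 4.3 as FUNCTIONS of `ψ` (choice + the uniqueness theorems): `IsConjugateSelfDual.infinityType`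
  / `.weightOf` (`𝔴_ψ`), `IsConjugateSymplectic.infinityType` / `.weightOf` / `.cmType` (`Φ_ψ :
  Literature.AlgebraicGeometry.Motives.CMType L`, the type `CMCode.ofCMType` consumes), each with its
  `has…` and `…_eq` (characterisation) lemmas, `odd_weightOf`, and `cmType_eq_of_hasInfinityType_weightOneType`
  (the weight-one characters of `exists_isConjugateSymplectic_hasInfinityType Φ` have `Φ_ψ = Φ`).

DICTIONARY (as in `ConjugateSelfDualCharacters`): `HasInfinityType L ψ e` ⇔ Liu's `𝔴_τ = |e w|` with
`τ' = w.embedding` if `e w < 0` and `τ' = conjugate w.embedding` if `e w > 0` (`arg(z) = z/|z|`, p. 4 L26).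
Liu's characters are `ℂ^×`-valued; "strictly unitary" (first sentence of the remark) is what lets the
tree work with `S¹`-valued `ψ` throughout — consumers quantify over `ψ : IdeleClassGroup L →ₜ* Circle`.

Everything here is proved from Mathlib and the tree; no named facts, no records.

## References

* Y. Liu, *Fourier–Jacobi cycles and arithmetic relative trace formula*, Camb. J. Math. 9 (2021), no. 1,
  1–147, arXiv:2102.11518 — p. 4 L26 (`arg`), §4.1 Remark 4.2 and Definition 4.3, p. 18. [Liu2021]
* A. Weil, *Basic Number Theory* (1967), Ch. IV §4 (polar decomposition of `K_∞ˣ`), Ch. VII §3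
  (characters of idele class groups and their infinity types). [WeilBNT1967]
-/

set_option autoImplicit false

noncomputable section

open _root_.Topology
open NumberField NumberField.InfinitePlace NumberField.InfinitePlace.Completion

namespace Literature.NumberTheory.Automorphic

open GaloisRepresentations InfiniteAdeleRing Literature.Analysis.Complex
open Literature.AlgebraicGeometry.Motives (CMType)
open Literature.RepresentationTheory.CompactGroups

variable (L : Type) [Field L] [NumberField L] [IsCMField L]

local notation3 "L⁺" => maximalRealSubfield L

namespace InfiniteAdeleRing

/-! ## § 1. The norm-one torus of a CM field is the archimedean torus `U(1)(L⁺ ⊗ ℝ)` -/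

/-- For a CM field, `y ∈ U(1)(L⁺ ⊗ ℝ)` (i.e. `y · ȳ = 1`) iff every component of `y` has absolute value
one. [folklore] -/
theorem mem_relNormOneInfUnits_iff_norm_eq_one (y : (InfiniteAdeleRing L)ˣ) :
    y ∈ relNormOneInfUnits L⁺ L ↔ ∀ w : InfinitePlace L, ‖(y : InfiniteAdeleRing L) w‖ = 1 := by
  refine ⟨fun hy w => norm_apply_eq_one_of_mem_relNormOneInfUnits L hy w, fun h => ?_⟩
  rw [mem_relNormOneInfUnits_iff_mul_conj]
  apply Units.ext
  funext w
  change (y : InfiniteAdeleRing L) w *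
      (IsCMField.complexConj L • ((y : InfiniteAdeleRing L))) w = 1
  apply (Completion.extensionEmbedding w).injective
  rw [map_mul, extensionEmbedding_complexConj_smul_units_apply, map_one, Complex.mul_conj,
    Complex.normSq_eq_norm_sq,
    (Completion.isometry_extensionEmbedding w).norm_map_of_map_zero (map_zero _), h w]
  simp

/-- For a CM field the archimedean torus `U(1)(L⁺ ⊗ ℝ)` IS the norm-one torus of `L_∞ˣ`. [folklore] -/
theorem relNormOneInfUnits_eq_normOneTorus : relNormOneInfUnits L⁺ L = normOneTorus L := by
  ext y
  rw [mem_relNormOneInfUnits_iff_norm_eq_one, mem_normOneTorus]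

/-! ## § 2. Positive real archimedean units are norms `s · s̄` and squares of totally positive base changes -/

/-- Complex conjugation fixes an archimedean unit all of whose components are real. [folklore] -/
theorem complexConj_smul_eq_self_of_real {s : (InfiniteAdeleRing L)ˣ} {r : InfinitePlace L → ℝ}
    (hs : ∀ w, Completion.extensionEmbedding w ((s : InfiniteAdeleRing L) w) = (r w : ℂ)) :
    IsCMField.complexConj L • s = s := by
  apply Units.ext
  funext w
  rw [GaloisRepresentations.ArchHerbrand.val_smul_units]
  apply (Completion.extensionEmbedding w).injective
  rw [extensionEmbedding_complexConj_smul_units_apply, hs w, Complex.conj_ofReal]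

/-- A positive real archimedean unit `p` is `s · (c • s)` for its positive real square root `s`; in
particular every character trivial on `{y · ȳ}` is trivial on `p`. [folklore] -/
theorem exists_mul_complexConj_smul_eq_of_mem_posRealUnits {p : (InfiniteAdeleRing L)ˣ}
    (hp : p ∈ posRealUnits L) :
    ∃ s : (InfiniteAdeleRing L)ˣ, s * IsCMField.complexConj L • s = p := by
  rw [mem_posRealUnits] at hp
  choose r hr hrp using hp
  have hx := fun w : InfinitePlace L => exists_extensionEmbedding_eq_ofReal L w (Real.sqrt (r w))
  choose x hx using hx
  have hsqrt : ∀ w, Real.sqrt (r w) ≠ 0 := fun w => (Real.sqrt_pos.2 (hr w)).ne'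
  have hx0 : ∀ w, x w ≠ 0 := by
    intro w h0
    have h := hx w
    rw [h0, map_zero] at h
    exact hsqrt w (by exact_mod_cast h.symm)
  have hux : @IsUnit (InfiniteAdeleRing L) _ (fun w => x w) :=
    Pi.isUnit_iff.mpr fun w => isUnit_iff_ne_zero.mpr (hx0 w)
  refine ⟨hux.unit, ?_⟩
  have hs : ∀ w, Completion.extensionEmbedding w ((hux.unit : InfiniteAdeleRing L) w) = (Real.sqrt (r w) : ℂ) :=
    fun w => by rw [IsUnit.unit_spec]; exact hx w
  rw [complexConj_smul_eq_self_of_real L hs]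
  apply Units.ext
  funext w
  change (hux.unit : InfiniteAdeleRing L) w * (hux.unit : InfiniteAdeleRing L) w = (p : InfiniteAdeleRing L) w
  apply (Completion.extensionEmbedding w).injective
  rw [map_mul, hs w, hrp w, ← Complex.ofReal_mul, Real.mul_self_sqrt (hr w).le]

/-- A positive real archimedean unit `p` of `L` is the square of the base change `s_L` of a TOTALLY
POSITIVE archimedean unit `s` of `L⁺` (`s_v = √(p_w)` for the place `w` above `v`). [folklore] -/
theorem exists_pos_infiniteIdeleBaseChange_mul_self_eq_of_mem_posRealUnits {p : (InfiniteAdeleRing L)ˣ}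
    (hp : p ∈ posRealUnits L) :
    ∃ s : (InfiniteAdeleRing L⁺)ˣ, (∀ v, 0 < ((cmRealCoord L s v : ℝˣ) : ℝ)) ∧
      infiniteIdeleBaseChange L⁺ L s * infiniteIdeleBaseChange L⁺ L s = p := by
  rw [mem_posRealUnits] at hp
  choose r hr hrp using hp
  -- the radius at the real place `v`, read at the complex place above it
  let ρ : InfinitePlace L⁺ → ℝ := fun v => Real.sqrt (r ((IsCMField.equivInfinitePlace L).symm v))
  have hρ : ∀ v, 0 < ρ v := fun v => Real.sqrt_pos.2 (hr _)
  have hρw : ∀ w : InfinitePlace L, ρ (w.comap (algebraMap L⁺ L)) = Real.sqrt (r w) := by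
    intro w
    show Real.sqrt (r ((IsCMField.equivInfinitePlace L).symm (w.comap (algebraMap L⁺ L)))) = Real.sqrt (r w)
    rw [← IsCMField.equivInfinitePlace_apply, Equiv.symm_apply_apply]
  let x : InfiniteAdeleRing L⁺ := fun v => (ringEquivRealOfIsReal (IsTotallyReal.isReal v)).symm (ρ v)
  have hx0 : ∀ v, x v ≠ 0 := fun v =>
    (map_ne_zero_iff _ (ringEquivRealOfIsReal (IsTotallyReal.isReal v)).symm.injective).2 (hρ v).ne'
  have hux : @IsUnit (InfiniteAdeleRing L⁺) _ x :=
    Pi.isUnit_iff.mpr fun v => isUnit_iff_ne_zero.mpr (hx0 v)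
  have hcoord : ∀ v, ((cmRealCoord L hux.unit v : ℝˣ) : ℝ) = ρ v := by
    intro v
    rw [coe_cmRealCoord, IsUnit.unit_spec]
    exact (ringEquivRealOfIsReal (IsTotallyReal.isReal v)).apply_symm_apply (ρ v)
  have hι : ∀ w : InfinitePlace L, Completion.extensionEmbedding w
      ((infiniteIdeleBaseChange L⁺ L hux.unit : InfiniteAdeleRing L) w) = (Real.sqrt (r w) : ℂ) := by
    intro w
    rw [← coe_infLocalUnits, infLocalUnits_infiniteIdeleBaseChange_of_isCMField, coe_ofRealUnits, hcoord, hρw]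
  refine ⟨hux.unit, fun v => by rw [hcoord]; exact hρ v, ?_⟩
  apply Units.ext
  funext w
  change (infiniteIdeleBaseChange L⁺ L hux.unit : InfiniteAdeleRing L) w *
      (infiniteIdeleBaseChange L⁺ L hux.unit : InfiniteAdeleRing L) w = (p : InfiniteAdeleRing L) w
  apply (Completion.extensionEmbedding w).injective
  rw [map_mul, hι w, hrp w, ← Complex.ofReal_mul, Real.mul_self_sqrt (hr w).le]

/-- The quadratic character `ε_{L/L⁺}` is `1` on the class of a totally positive archimedean unit of `L⁺`
(its archimedean components are the sign characters). [folklore] -/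
theorem quadraticClassCharCM_infUnitsToClass_eq_one_of_pos (s : (InfiniteAdeleRing L⁺)ˣ)
    (hs : ∀ v, 0 < ((cmRealCoord L s v : ℝˣ) : ℝ)) : quadraticClassCharCM L (infUnitsToClass L⁺ s) = 1 := by
  rw [quadraticClassCharCM_infUnitsToClass_eq_prod]
  exact Finset.prod_eq_one fun v _ => unitPart_ofRealUnits_of_pos _ (hs v)

/-! ## § 3. Characters of `L_∞ˣ` trivial on the positive real units are ∞-type characters -/

omit [IsCMField L] in
/-- On a positive real archimedean unit every ∞-type character is trivial (`arg` of a positive real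
is `1`). [folklore] -/
theorem infinityTypeChar_eq_one_of_mem_posRealUnits (e : InfinitePlace L → ℤ) {p : (InfiniteAdeleRing L)ˣ}
    (hp : p ∈ posRealUnits L) : infinityTypeChar L e p = 1 := by
  rw [mem_posRealUnits] at hp
  rw [infinityTypeChar_apply]
  refine Finset.prod_eq_one fun w _ => ?_
  obtain ⟨r, hr, hrp⟩ := hp w
  have h1 : unitPart (infLocalUnits L w p) = 1 := by
    apply Circle.ext
    rw [coe_unitPart, coe_infLocalUnits, hrp, Complex.norm_real, Real.norm_of_nonneg hr.le,
      div_self (by exact_mod_cast hr.ne'), Circle.coe_one]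
  rw [h1, one_zpow]

omit [NumberField L] [IsCMField L] in
/-- On the norm-one torus the factors of an ∞-type character are the components themselves:
`arg(ι_w t_w) = ι_w t_w`. [folklore] -/
theorem coe_unitPart_infLocalUnits_of_mem_normOneTorus {t : (InfiniteAdeleRing L)ˣ}
    (ht : t ∈ normOneTorus L) (w : InfinitePlace L) :
    (unitPart (infLocalUnits L w t) : ℂ) =
      Completion.extensionEmbedding w ((t : InfiniteAdeleRing L) w) := by
  rw [unitPart_apply_of_norm_eq_one _ ?_, coe_infLocalUnits]
  rw [coe_infLocalUnits, (Completion.isometry_extensionEmbedding w).norm_map_of_map_zero (map_zero _)]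
  exact (mem_normOneTorus L t).1 ht w

/-- **Existence of the ∞-type** ([Liu21] Remark 4.2, archimedean content): for a CM field `L`, a
continuous character `χ : L_∞ˣ →* S¹` trivial on the positive real units is the ∞-type character of some
tuple `e : InfinitePlace L → ℤ`: `χ u = ∏_w arg(ι_w u_w)^{e w}`. [cite: Liu2021, Remark 4.2] -/
theorem exists_eq_infinityTypeChar_of_posRealUnits (χ : (InfiniteAdeleRing L)ˣ →* Circle)
    (hχ : Continuous χ) (h : ∀ p ∈ posRealUnits L, χ p = 1) :
    ∃ e : InfinitePlace L → ℤ, ∀ u, χ u = infinityTypeChar L e u := by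
  classical
  -- the exponents, read off the one-place subtori of `U(1)(L⁺ ⊗ ℝ) = ∏_w U(1)`
  have hn : ∀ w : InfinitePlace L, ∃ n : ℤ, ∀ z : Circle,
      χ ((archCoord L w z : relNormOneInfUnits L⁺ L) : (InfiniteAdeleRing L)ˣ) = z ^ n := by
    intro w
    obtain ⟨n, hn⟩ := CircleChar.eq_zpow
      (χ.comp ((relNormOneInfUnits L⁺ L).subtype.comp (archCoord L w)))
      (hχ.comp (continuous_subtype_val.comp (continuous_archCoord L w)))
    exact ⟨n, fun z => by simpa only [MonoidHom.comp_apply, Subgroup.coe_subtype] using hn z⟩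
  choose e he using hn
  refine ⟨e, fun u => ?_⟩
  obtain ⟨p, hp, t, ht, rfl⟩ := exists_posReal_mul_normOne L u
  -- the positive real part is killed by both sides
  have hp1 : χ p = 1 := h p hp
  have hp2 : infinityTypeChar L e p = 1 := infinityTypeChar_eq_one_of_mem_posRealUnits L e hp
  -- the torus part: decompose along the one-place subtori
  have ht' : t ∈ relNormOneInfUnits L⁺ L := by
    rw [relNormOneInfUnits_eq_normOneTorus]; exact ht
  have ht_eq : t = ∏ w : InfinitePlace L,
      ((archCoord L w (archPlaceChars L ⟨t, ht'⟩ w) : relNormOneInfUnits L⁺ L) : (InfiniteAdeleRing L)ˣ) := by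
    have hprod := congrArg ((relNormOneInfUnits L⁺ L).subtype) (eq_prod_archCoord L ⟨t, ht'⟩)
    rw [map_prod] at hprod
    simpa only [Subgroup.coe_subtype, Subtype.coe_mk] using hprod
  have key : χ t = infinityTypeChar L e t := by
    rw [infinityTypeChar_apply]
    conv_lhs => rw [ht_eq, map_prod]
    refine Finset.prod_congr rfl fun w _ => ?_
    rw [he w]
    congr 1
    apply Circle.ext
    rw [archPlaceChars_apply, coe_archPlaceChar, coe_unitPart_infLocalUnits_of_mem_normOneTorus L ht w]
  rw [map_mul, map_mul, hp1, hp2, key]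

/-- The tuple of `exists_eq_infinityTypeChar_of_posRealUnits` is unique (all places of a CM field are
complex). [folklore] -/
theorem existsUnique_eq_infinityTypeChar_of_posRealUnits (χ : (InfiniteAdeleRing L)ˣ →* Circle)
    (hχ : Continuous χ) (h : ∀ p ∈ posRealUnits L, χ p = 1) :
    ∃! e : InfinitePlace L → ℤ, ∀ u, χ u = infinityTypeChar L e u := by
  obtain ⟨e, he⟩ := exists_eq_infinityTypeChar_of_posRealUnits L χ hχ h
  refine ⟨e, he, fun e' he' => funext fun w => ?_⟩
  have hee : infinityTypeChar L e' = infinityTypeChar L e :=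
    MonoidHom.ext fun u => by rw [← he' u, he u]
  exact infinityTypeChar_injective_of_isComplex L hee (IsTotallyComplex.isComplex w)

/-- Variant: a continuous `χ : L_∞ˣ →* S¹` with `χ (y · (c • y)) = 1` for all `y` is an ∞-type character
(a positive real unit is `s · (c • s)` for its square root `s`). [cite: Liu2021, Remark 4.2] -/
theorem exists_eq_infinityTypeChar_of_mul_conj_smul (χ : (InfiniteAdeleRing L)ˣ →* Circle)
    (hχ : Continuous χ)
    (h : ∀ y : (InfiniteAdeleRing L)ˣ, χ (y * IsCMField.complexConj L • y) = 1) :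
    ∃ e : InfinitePlace L → ℤ, ∀ u, χ u = infinityTypeChar L e u :=
  exists_eq_infinityTypeChar_of_posRealUnits L χ hχ fun p hp => by
    obtain ⟨s, hs⟩ := exists_mul_complexConj_smul_eq_of_mem_posRealUnits L hp
    rw [← hs]
    exact h s

end InfiniteAdeleRing

namespace IdeleClassGroup

/-! ## § 4. Conjugate self-dual / symplectic / orthogonal idele class characters have an ∞-type -/

variable {L}

/-- The restriction of a conjugate self-dual `ψ : C_L →ₜ* S¹` to `L_∞ˣ` kills `y · ȳ`. [folklore] -/
theorem IsConjugateSelfDual.apply_infUnitsToClass_mul_complexConj_smul {ψ : IdeleClassGroup L →ₜ* Circle}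
    (hψ : IsConjugateSelfDual L ψ) (y : (InfiniteAdeleRing L)ˣ) :
    ψ (infUnitsToClass L (y * IsCMField.complexConj L • y)) = 1 := by
  rw [infUnitsToClass_apply, map_mul, ← galSmul_infiniteIdeles]
  exact (isConjugateSelfDual_iff_mul_conj ψ).1 hψ (infiniteIdeles L y)

/-- A conjugate self-dual character is trivial on the classes of the positive real archimedean units.
[folklore] -/
theorem IsConjugateSelfDual.apply_infUnitsToClass_of_mem_posRealUnits {ψ : IdeleClassGroup L →ₜ* Circle}
    (hψ : IsConjugateSelfDual L ψ) {p : (InfiniteAdeleRing L)ˣ} (hp : p ∈ posRealUnits L) :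
    ψ (infUnitsToClass L p) = 1 := by
  obtain ⟨s, hs⟩ := InfiniteAdeleRing.exists_mul_complexConj_smul_eq_of_mem_posRealUnits L hp
  rw [← hs]
  exact hψ.apply_infUnitsToClass_mul_complexConj_smul s

/-- A conjugate SYMPLECTIC character is trivial on the classes of the positive real archimedean units:
`p = s_L²` with `s ∈ L⁺_∞ˣ` totally positive, and `ψ[s_L] = ε[s] = 1`.  (No appeal to `ε ∘ N_{L/L⁺} = 1`.)
[folklore] -/
theorem IsConjugateSymplectic.apply_infUnitsToClass_of_mem_posRealUnits {ψ : IdeleClassGroup L →ₜ* Circle}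
    (hψ : IsConjugateSymplectic L ψ) {p : (InfiniteAdeleRing L)ˣ} (hp : p ∈ posRealUnits L) :
    ψ (infUnitsToClass L p) = 1 := by
  obtain ⟨s, hs, hsp⟩ :=
    InfiniteAdeleRing.exists_pos_infiniteIdeleBaseChange_mul_self_eq_of_mem_posRealUnits L hp
  rw [← hsp, map_mul, map_mul, ← classBaseChange_infUnitsToClass, hψ,
    InfiniteAdeleRing.quadraticClassCharCM_infUnitsToClass_eq_one_of_pos L s hs, one_mul]

/-- A conjugate orthogonal character is trivial on the classes of the positive real archimedean units.
[folklore] -/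
theorem IsConjugateOrthogonal.apply_infUnitsToClass_of_mem_posRealUnits {ψ : IdeleClassGroup L →ₜ* Circle}
    (hψ : IsConjugateOrthogonal L ψ) {p : (InfiniteAdeleRing L)ˣ} (hp : p ∈ posRealUnits L) :
    ψ (infUnitsToClass L p) = 1 :=
  hψ.isConjugateSelfDual.apply_infUnitsToClass_of_mem_posRealUnits hp

/-- A continuous `ψ : C_L →ₜ* S¹` trivial on the classes of the positive real archimedean units has an
∞-type. [cite: WeilBNT1967, Ch. VII §3] -/
theorem exists_hasInfinityType_of_posRealUnits {ψ : IdeleClassGroup L →ₜ* Circle}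
    (h : ∀ p ∈ posRealUnits L, ψ (infUnitsToClass L p) = 1) :
    ∃ e : InfinitePlace L → ℤ, HasInfinityType L ψ e := by
  obtain ⟨e, he⟩ := InfiniteAdeleRing.exists_eq_infinityTypeChar_of_posRealUnits L
    (ψ.toMonoidHom.comp (infUnitsToClass L)) (ψ.continuous.comp (continuous_infUnitsToClass L))
    (fun p hp => h p hp)
  exact ⟨e, fun u => he u⟩

/-- **[Liu21] Remark 4.2 (existence of the ∞-type).** A conjugate self-dual unitary idele class
character of a CM field has an ∞-type: `ψ[u] = ∏_w arg(ι_w u_w)^{e w}` on `L_∞ˣ` for some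
`e : InfinitePlace L → ℤ`. [cite: Liu2021, Remark 4.2] -/
theorem IsConjugateSelfDual.exists_hasInfinityType {ψ : IdeleClassGroup L →ₜ* Circle}
    (hψ : IsConjugateSelfDual L ψ) : ∃ e : InfinitePlace L → ℤ, HasInfinityType L ψ e :=
  exists_hasInfinityType_of_posRealUnits fun _ hp => hψ.apply_infUnitsToClass_of_mem_posRealUnits hp

/-- The ∞-type of a conjugate self-dual character exists AND is unique. [cite: Liu2021, Remark 4.2] -/
theorem IsConjugateSelfDual.existsUnique_hasInfinityType {ψ : IdeleClassGroup L →ₜ* Circle}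
    (hψ : IsConjugateSelfDual L ψ) : ∃! e : InfinitePlace L → ℤ, HasInfinityType L ψ e := by
  obtain ⟨e, he⟩ := hψ.exists_hasInfinityType
  exact ⟨e, he, fun e' he' => hasInfinityType_unique he' he⟩

/-- **[Liu21] Remark 4.2 for conjugate symplectic characters** (no self-duality hypothesis needed): a
conjugate symplectic `ψ : C_L →ₜ* S¹` has an ∞-type. [cite: Liu2021, Remark 4.2] -/
theorem IsConjugateSymplectic.exists_hasInfinityType {ψ : IdeleClassGroup L →ₜ* Circle}
    (hψ : IsConjugateSymplectic L ψ) : ∃ e : InfinitePlace L → ℤ, HasInfinityType L ψ e :=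
  exists_hasInfinityType_of_posRealUnits fun _ hp => hψ.apply_infUnitsToClass_of_mem_posRealUnits hp

/-- … and it is unique. [cite: Liu2021, Remark 4.2] -/
theorem IsConjugateSymplectic.existsUnique_hasInfinityType {ψ : IdeleClassGroup L →ₜ* Circle}
    (hψ : IsConjugateSymplectic L ψ) : ∃! e : InfinitePlace L → ℤ, HasInfinityType L ψ e := by
  obtain ⟨e, he⟩ := hψ.exists_hasInfinityType
  exact ⟨e, he, fun e' he' => hasInfinityType_unique he' he⟩

/-- A conjugate orthogonal character has an ∞-type, with all exponents even. [cite: Liu2021, Remark 4.2] -/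
theorem IsConjugateOrthogonal.exists_hasInfinityType_even {ψ : IdeleClassGroup L →ₜ* Circle}
    (hψ : IsConjugateOrthogonal L ψ) :
    ∃ e : InfinitePlace L → ℤ, HasInfinityType L ψ e ∧ ∀ w, Even (e w) := by
  obtain ⟨e, he⟩ := hψ.isConjugateSelfDual.exists_hasInfinityType
  exact ⟨e, he, hψ.even he⟩

/-- **[Liu21] Remark 4.2 / Definition 4.3 for a conjugate symplectic character, in full**: there is an
∞-type `e` with every `e w` odd (so nowhere zero), whence odd weights `|e w|` and the CM type
`cmTypeOf L e`. [cite: Liu2021, Remark 4.2, Definition 4.3] -/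
theorem IsConjugateSymplectic.exists_hasInfinityType_odd {ψ : IdeleClassGroup L →ₜ* Circle}
    (hψ : IsConjugateSymplectic L ψ) :
    ∃ (e : InfinitePlace L → ℤ) (he : ∀ w, e w ≠ 0), HasInfinityType L ψ e ∧ (∀ w, Odd (e w)) ∧
      HasWeight L ψ (weight e) ∧ HasCMType L ψ (cmTypeOf L e he) := by
  obtain ⟨e, he⟩ := hψ.exists_hasInfinityType
  exact ⟨e, hψ.ne_zero he, he, hψ.odd he, hasWeight_of_hasInfinityType he, hasCMType_cmTypeOf he _⟩

/-! ## § 5. `𝔴_ψ` and `Φ_ψ` as functions of `ψ` ([Liu21] Definition 4.3) -/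

/-- The ∞-type of a conjugate self-dual character, as a function of `ψ` (by `exists_hasInfinityType` and
choice; characterised by `hasInfinityType_infinityType` / `infinityType_eq`). [cite: Liu2021, Remark 4.2] -/
def IsConjugateSelfDual.infinityType {ψ : IdeleClassGroup L →ₜ* Circle} (hψ : IsConjugateSelfDual L ψ) :
    InfinitePlace L → ℤ :=
  hψ.exists_hasInfinityType.choose

/-- `ψ` has the ∞-type `hψ.infinityType`. [folklore] -/
theorem IsConjugateSelfDual.hasInfinityType_infinityType {ψ : IdeleClassGroup L →ₜ* Circle}
    (hψ : IsConjugateSelfDual L ψ) : HasInfinityType L ψ hψ.infinityType :=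
  hψ.exists_hasInfinityType.choose_spec

/-- Any ∞-type of `ψ` is `hψ.infinityType`. [folklore] -/
theorem IsConjugateSelfDual.infinityType_eq {ψ : IdeleClassGroup L →ₜ* Circle} (hψ : IsConjugateSelfDual L ψ)
    {e : InfinitePlace L → ℤ} (he : HasInfinityType L ψ e) : hψ.infinityType = e :=
  hasInfinityType_unique hψ.hasInfinityType_infinityType he

/-- **Definition 4.3 (the weight `𝔴_ψ`)** of a conjugate self-dual character, as a function of `ψ`.
[cite: Liu2021, Definition 4.3] -/
def IsConjugateSelfDual.weightOf {ψ : IdeleClassGroup L →ₜ* Circle} (hψ : IsConjugateSelfDual L ψ) :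
    InfinitePlace L → ℕ :=
  weight hψ.infinityType

/-- `ψ` has the weight `hψ.weightOf`. [folklore] -/
theorem IsConjugateSelfDual.hasWeight_weightOf {ψ : IdeleClassGroup L →ₜ* Circle}
    (hψ : IsConjugateSelfDual L ψ) : HasWeight L ψ hψ.weightOf :=
  hasWeight_of_hasInfinityType hψ.hasInfinityType_infinityType

/-- Any weight of `ψ` is `hψ.weightOf`. [folklore] -/
theorem IsConjugateSelfDual.weightOf_eq {ψ : IdeleClassGroup L →ₜ* Circle} (hψ : IsConjugateSelfDual L ψ)
    {𝔴 : InfinitePlace L → ℕ} (h : HasWeight L ψ 𝔴) : hψ.weightOf = 𝔴 :=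
  HasWeight.unique hψ.hasWeight_weightOf h

/-- The ∞-type of a conjugate SYMPLECTIC character, as a function of `ψ`. [cite: Liu2021, Remark 4.2] -/
def IsConjugateSymplectic.infinityType {ψ : IdeleClassGroup L →ₜ* Circle}
    (hψ : IsConjugateSymplectic L ψ) : InfinitePlace L → ℤ :=
  hψ.exists_hasInfinityType.choose

/-- `ψ` has the ∞-type `hψ.infinityType`. [folklore] -/
theorem IsConjugateSymplectic.hasInfinityType_infinityType {ψ : IdeleClassGroup L →ₜ* Circle}
    (hψ : IsConjugateSymplectic L ψ) : HasInfinityType L ψ hψ.infinityType :=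
  hψ.exists_hasInfinityType.choose_spec

/-- Any ∞-type of `ψ` is `hψ.infinityType`. [folklore] -/
theorem IsConjugateSymplectic.infinityType_eq {ψ : IdeleClassGroup L →ₜ* Circle}
    (hψ : IsConjugateSymplectic L ψ) {e : InfinitePlace L → ℤ} (he : HasInfinityType L ψ e) :
    hψ.infinityType = e :=
  hasInfinityType_unique hψ.hasInfinityType_infinityType he

/-- Every exponent of a conjugate symplectic character is odd. [cite: Liu2021, Remark 4.2] -/
theorem IsConjugateSymplectic.odd_infinityType {ψ : IdeleClassGroup L →ₜ* Circle}
    (hψ : IsConjugateSymplectic L ψ) (w : InfinitePlace L) : Odd (hψ.infinityType w) :=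
  hψ.odd hψ.hasInfinityType_infinityType w

/-- … hence non-zero. [folklore] -/
theorem IsConjugateSymplectic.infinityType_ne_zero {ψ : IdeleClassGroup L →ₜ* Circle}
    (hψ : IsConjugateSymplectic L ψ) (w : InfinitePlace L) : hψ.infinityType w ≠ 0 :=
  hψ.ne_zero hψ.hasInfinityType_infinityType w

/-- **Definition 4.3 (the weight `𝔴_ψ`)** of a conjugate symplectic character, as a function of `ψ`; all its
values are odd (`odd_weightOf`). [cite: Liu2021, Definition 4.3] -/
def IsConjugateSymplectic.weightOf {ψ : IdeleClassGroup L →ₜ* Circle} (hψ : IsConjugateSymplectic L ψ) :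
    InfinitePlace L → ℕ :=
  weight hψ.infinityType

/-- `ψ` has the weight `hψ.weightOf`. [folklore] -/
theorem IsConjugateSymplectic.hasWeight_weightOf {ψ : IdeleClassGroup L →ₜ* Circle}
    (hψ : IsConjugateSymplectic L ψ) : HasWeight L ψ hψ.weightOf :=
  hasWeight_of_hasInfinityType hψ.hasInfinityType_infinityType

/-- Any weight of `ψ` is `hψ.weightOf`. [folklore] -/
theorem IsConjugateSymplectic.weightOf_eq {ψ : IdeleClassGroup L →ₜ* Circle} (hψ : IsConjugateSymplectic L ψ)
    {𝔴 : InfinitePlace L → ℕ} (h : HasWeight L ψ 𝔴) : hψ.weightOf = 𝔴 :=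
  HasWeight.unique hψ.hasWeight_weightOf h

/-- The weights of a conjugate symplectic character are odd. [cite: Liu2021, Remark 4.2] -/
theorem IsConjugateSymplectic.odd_weightOf {ψ : IdeleClassGroup L →ₜ* Circle}
    (hψ : IsConjugateSymplectic L ψ) (w : InfinitePlace L) : Odd (hψ.weightOf w) := by
  rw [IsConjugateSymplectic.weightOf, weight_apply, Int.natAbs_odd]
  exact hψ.odd_infinityType w

/-- **Definition 4.3 (the CM type `Φ_ψ`)** of a conjugate symplectic character, as a function of `ψ` — the
SAME `Literature.AlgebraicGeometry.Motives.CMType L` that `CMCode.ofCMType` consumes.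
[cite: Liu2021, Definition 4.3] -/
def IsConjugateSymplectic.cmType {ψ : IdeleClassGroup L →ₜ* Circle} (hψ : IsConjugateSymplectic L ψ) :
    CMType L :=
  cmTypeOf L hψ.infinityType hψ.infinityType_ne_zero

/-- `ψ` has the CM type `hψ.cmType`. [folklore] -/
theorem IsConjugateSymplectic.hasCMType_cmType {ψ : IdeleClassGroup L →ₜ* Circle}
    (hψ : IsConjugateSymplectic L ψ) : HasCMType L ψ hψ.cmType :=
  hasCMType_cmTypeOf hψ.hasInfinityType_infinityType _

/-- Any CM type of `ψ` is `hψ.cmType`. [folklore] -/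
theorem IsConjugateSymplectic.cmType_eq {ψ : IdeleClassGroup L →ₜ* Circle} (hψ : IsConjugateSymplectic L ψ)
    {Φ : CMType L} (h : HasCMType L ψ Φ) : hψ.cmType = Φ :=
  HasCMType.unique hψ.hasCMType_cmType h

/-- For the weight-one characters of `exists_isConjugateSymplectic_hasInfinityType Φ` the CM type is `Φ`.
[folklore] -/
theorem IsConjugateSymplectic.cmType_eq_of_hasInfinityType_weightOneType {ψ : IdeleClassGroup L →ₜ* Circle}
    (hψ : IsConjugateSymplectic L ψ) {Φ : CMType L} (he : HasInfinityType L ψ (weightOneType L Φ)) :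
    hψ.cmType = Φ :=
  hψ.cmType_eq ⟨weightOneType L Φ, weightOneType_ne_zero Φ, he, cmTypeOf_weightOneType Φ⟩

end IdeleClassGroup

end Literature.NumberTheory.Automorphic
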